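import Mathlib
import Summits.Ventures.HodgeRepro2.LevelPositivity
import Summits.Ventures.HodgeRepro2.LevelBaseChange

/-!
# Counting invariants: direct sums, equivariant transport, the Step 5 identity, central characters

Kernel annex of sub-claim B5 (single-level positivity + level), file 5. This file formalises the
linear-algebra content of Lemma B5.7 (in its EQUALITY form), of Step 5 of the proof of
Theorem B5.1 (the Hom-form (iv)) and of Proposition B5.3(e) (the central-character constraint) of
the owner section `route/T4-B5-p8.md`. Nothing arithmetic is asserted: the printed theorems
(Liu 2021 Thm. 4.18 — the `ℂ[G(A_F^∞)]`-isomorphism `Ω(μ) ⊗_{M̃_μ} ℂ ≃ ⊕_{(ε,χ)} ω(μ, ε, χ)` and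
its clause (1) `Ω(μ)^K ≃ Hom_E(A_K, A_μ)_ℚ`; App. D.1 Step 3 — the central character of
`ω(μ_v, ε_v, χ_v)`) enter as HYPOTHESES (`e`, `he`, `f`, `hzc`).

* `piRep ω` — the direct sum (= product, finite index set) of a family of representations;
  `mem_invariants_piRep_iff`, `invariants_piRep`, `finrank_invariants_piRep`
  (Lemma B5.7: `(⊕_j W_j)^K = ⊕_j W_j^K` and `dim (⊕_j W_j)^K = Σ_j dim W_j^K`).
* `map_invariants_of_equivariant`, `finrank_invariants_congr` — Lemma B5.7, last sentence:
  an isomorphism of `k[G]`-modules maps `K`-invariants onto `K`-invariants.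
* `finrank_invariants_baseChangeRep`, `finrank_mul_finrank_invariants`, `step5_identity`,
  `step5_count` — Step 5: `[M : Q] · dim_C (Ω ⊗_M C)^{K'} = dim_Q Ω^{K'} = dim_Q H`, and with the
  direct-sum decomposition `[M : Q] · Σ_j dim_C ω_j^{K'} = dim_Q H` (Liu's
  `d(μ, K') · [M̃_μ : ℚ] = dim_ℚ Hom_E(A_{K'}, A_μ)_ℚ`, with `Q = ℚ`, `M = M̃_μ`, `C = ℂ`).
* `exists_ne_zero_of_step5` — the conclusion of Step 5 used by B7: if one count is `≥ 1`, then
  `H ≠ 0` (the «in particular `Hom_E(A_{K'}, A_{μ_i}) ≠ 0`» of Theorem B5.1(iv)).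
* `central_character_eq_one` — Proposition B5.3(e): if `z ∈ K'` acts by the scalar `c` and a
  non-zero `K'`-invariant vector exists, then `c = 1`.
-/

namespace Summit.Ventures.HodgeRepro2.LevelPositivity

open Module TensorProduct

variable {G : Type*} [Group G] {k : Type*} [Field k]

section Pi

variable {J : Type*} {V : J → Type*} [∀ j, AddCommGroup (V j)] [∀ j, Module k (V j)]

/-- The direct sum (product, for a finite index set) of a family of representations `ω j`:
`G` acts componentwise. -/
def piRep (ω : ∀ j, Representation k G (V j)) : Representation k G (∀ j, V j) where
  toFun g := LinearMap.pi fun j => (ω j g).comp (LinearMap.proj j)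
  map_one' := by
    ext x j
    simp
  map_mul' g h := by
    ext x j
    simp

/-- The componentwise action. -/
@[simp]
theorem piRep_apply (ω : ∀ j, Representation k G (V j)) (g : G) (x : ∀ j, V j) (j : J) :
    piRep ω g x j = ω j g (x j) :=
  rfl

/-- Lemma B5.7, first sentence: a vector of the direct sum is `K`-invariant iff each component is. -/
theorem mem_invariants_piRep_iff {ω : ∀ j, Representation k G (V j)} {K : Subgroup G}
    {x : ∀ j, V j} : x ∈ invariants (piRep ω) K ↔ ∀ j, x j ∈ invariants (ω j) K := by
  simp only [mem_invariants_iff]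
  constructor
  · intro h j g hg
    have := congrFun (h g hg) j
    simpa using this
  · intro h g hg
    funext j
    exact h j g hg

/-- Lemma B5.7: `(⊕_j W_j)^K = ⊕_j W_j^K`, as submodules of the product. -/
theorem invariants_piRep (ω : ∀ j, Representation k G (V j)) (K : Subgroup G) :
    invariants (piRep ω) K = Submodule.pi Set.univ (fun j => invariants (ω j) K) := by
  ext x
  rw [mem_invariants_piRep_iff, Submodule.mem_pi]
  simp

/-- The product of a family of submodules, as a submodule of the product, is linearly equivalent
to the product of the submodules. -/
def piSubmoduleEquiv (p : ∀ j, Submodule k (V j)) :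
    (Submodule.pi Set.univ p) ≃ₗ[k] (∀ j, p j) where
  toFun x j := ⟨x.1 j, Submodule.mem_pi.1 x.2 j (Set.mem_univ j)⟩
  invFun y := ⟨fun j => (y j).1, Submodule.mem_pi.2 fun j _ => (y j).2⟩
  map_add' _ _ := rfl
  map_smul' _ _ := rfl
  left_inv _ := rfl
  right_inv _ := rfl

/-- Lemma B5.7, the count: `dim_k (⊕_j W_j)^K = Σ_j dim_k W_j^K` for a finite family whose
`K`-invariants are finite-dimensional (admissibility). The printed sum of Cor. 4.20 runs over all
pairs `(ε, χ)` but has finite support (the printed «the integer `d(μ, K)`»), so it is the sum over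
a finite family. -/
theorem finrank_invariants_piRep [Fintype J] (ω : ∀ j, Representation k G (V j)) (K : Subgroup G)
    [∀ j, FiniteDimensional k (invariants (ω j) K)] :
    finrank k (invariants (piRep ω) K) = ∑ j, finrank k (invariants (ω j) K) := by
  rw [(LinearEquiv.ofEq _ _ (invariants_piRep ω K)).finrank_eq,
    (piSubmoduleEquiv fun j => invariants (ω j) K).finrank_eq, Module.finrank_pi_fintype]

end Pi

section Transport

variable {V W : Type*} [AddCommGroup V] [Module k V] [AddCommGroup W] [Module k W]

/-- Lemma B5.7, last sentence: a `G`-equivariant linear equivalence maps the `K`-invariants of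
the source onto the `K`-invariants of the target. -/
theorem map_invariants_of_equivariant (ρ : Representation k G V) (ρ' : Representation k G W)
    (e : V ≃ₗ[k] W) (he : ∀ g v, e (ρ g v) = ρ' g (e v)) (K : Subgroup G) :
    (invariants ρ K).map (e : V →ₗ[k] W) = invariants ρ' K := by
  ext w
  constructor
  · rintro ⟨v, hv, rfl⟩
    rw [SetLike.mem_coe, mem_invariants_iff] at hv
    rw [mem_invariants_iff]
    intro g hg
    rw [LinearEquiv.coe_coe, ← he, hv g hg]
  · intro hw
    rw [mem_invariants_iff] at hw
    refine ⟨e.symm w, ?_, by simp⟩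
    rw [SetLike.mem_coe, mem_invariants_iff]
    intro g hg
    apply e.injective
    rw [he, e.apply_symm_apply, hw g hg]

/-- Isomorphic `k[G]`-modules have `K`-invariants of the same dimension. -/
theorem finrank_invariants_congr (ρ : Representation k G V) (ρ' : Representation k G W)
    (e : V ≃ₗ[k] W) (he : ∀ g v, e (ρ g v) = ρ' g (e v)) (K : Subgroup G) :
    finrank k (invariants ρ K) = finrank k (invariants ρ' K) := by
  rw [← map_invariants_of_equivariant ρ ρ' e he K]
  exact (e.submoduleMap (invariants ρ K)).finrank_eq

end Transport

section Count

variable {Q M C : Type*} [Field Q] [Field M] [Field C] [Algebra Q M] [Algebra M C]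
variable {V : Type*} [AddCommGroup V] [Module M V] [Module Q V] [IsScalarTower Q M V]

/-- The `K'`-invariants of a representation commute with extension of scalars (file 2,
`finrank_invariants_baseChange`, applied to the restriction to `K'`): the restriction of the
base-changed representation to `K'` is the base change of the restriction. -/
theorem restrict_baseChangeRep (Ω : Representation M G V) (K' : Subgroup G) :
    restrict (baseChangeRep (C := C) Ω) K' = baseChangeRep (restrict Ω K') :=
  MonoidHom.ext fun _ => rfl

/-- Lemma B5.6 at level `K'`: `dim_C (C ⊗_M V)^{K'} = dim_M V^{K'}`. -/
theorem finrank_invariants_baseChangeRep (Ω : Representation M G V) (K' : Subgroup G) :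
    finrank C (invariants (baseChangeRep (C := C) Ω) K') = finrank M (invariants Ω K') := by
  unfold invariants
  rw [restrict_baseChangeRep]
  exact finrank_invariants_baseChange (restrict Ω K')

/-- Step 5, the tower law: `[M : Q] · dim_C (C ⊗_M V)^{K'} = dim_Q V^{K'}`
(`Module.finrank_mul_finrank` for `Q ⊆ M` and the `M`-vector space `V^{K'}`). -/
theorem finrank_mul_finrank_invariants (Ω : Representation M G V) (K' : Subgroup G) :
    finrank Q M * finrank C (invariants (baseChangeRep (C := C) Ω) K') =
      finrank Q (invariants Ω K') := by
  rw [finrank_invariants_baseChangeRep]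
  exact Module.finrank_mul_finrank Q M (invariants Ω K')

/-- Step 5 with the printed clause (1) of Thm. 4.18 as the hypothesis `f` (any `Q`-linear
isomorphism `V^{K'} ≃ H`; for Liu, `V = Ω(μ)`, `H = Hom_E(A_{K'}, A_μ)_ℚ`, `Q = ℚ`, `M = M̃_μ`):
`[M : Q] · dim_C (C ⊗_M V)^{K'} = dim_Q H`. -/
theorem step5_identity (Ω : Representation M G V) (K' : Subgroup G) {H : Type*} [AddCommGroup H]
    [Module Q H] (f : invariants Ω K' ≃ₗ[Q] H) :
    finrank Q M * finrank C (invariants (baseChangeRep (C := C) Ω) K') = finrank Q H := by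
  rw [finrank_mul_finrank_invariants, f.finrank_eq]

/-- Step 5 in full: with the printed isomorphism of `C[G]`-modules `C ⊗_M V ≃ ⊕_j W_j`
(hypotheses `e`, `he` — Liu Thm. 4.18 with `W_j = ω(μ, ε, χ)`, `j = (ε, χ)` running over the
finite support) and the printed `Q`-linear isomorphism `V^{K'} ≃ H` (hypothesis `f` — Thm. 4.18(1)),
`[M : Q] · Σ_j dim_C W_j^{K'} = dim_Q H`, i.e. `d(μ, K') · [M̃_μ : ℚ] = dim_ℚ Hom_E(A_{K'}, A_μ)_ℚ`. -/
theorem step5_count {J : Type*} [Fintype J] {W : J → Type*} [∀ j, AddCommGroup (W j)]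
    [∀ j, Module C (W j)] (Ω : Representation M G V) (ω : ∀ j, Representation C G (W j))
    (e : (C ⊗[M] V) ≃ₗ[C] (∀ j, W j)) (he : ∀ g x, e (baseChangeRep Ω g x) = piRep ω g (e x))
    (K' : Subgroup G) [∀ j, FiniteDimensional C (invariants (ω j) K')] {H : Type*}
    [AddCommGroup H] [Module Q H] (f : invariants Ω K' ≃ₗ[Q] H) :
    finrank Q M * ∑ j, finrank C (invariants (ω j) K') = finrank Q H := by
  rw [← finrank_invariants_piRep, ← finrank_invariants_congr (baseChangeRep Ω) (piRep ω) e he K',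
    step5_identity Ω K' f]

/-- The conclusion of Step 5 used by B7 («in particular `Hom_E(A_{K'}, A_{μ_i}) ≠ 0`»): if `M` is
a finite extension of `Q` (a number field) and one of the counts is `≥ 1` (Step 3), then `H` has a
non-zero element. -/
theorem exists_ne_zero_of_step5 {J : Type*} [Fintype J] {W : J → Type*} [∀ j, AddCommGroup (W j)]
    [∀ j, Module C (W j)] [FiniteDimensional Q M] (Ω : Representation M G V)
    (ω : ∀ j, Representation C G (W j)) (e : (C ⊗[M] V) ≃ₗ[C] (∀ j, W j))
    (he : ∀ g x, e (baseChangeRep Ω g x) = piRep ω g (e x)) (K' : Subgroup G)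
    [∀ j, FiniteDimensional C (invariants (ω j) K')] {H : Type*} [AddCommGroup H] [Module Q H]
    (f : invariants Ω K' ≃ₗ[Q] H) (hpos : 1 ≤ ∑ j, finrank C (invariants (ω j) K')) :
    ∃ h : H, h ≠ 0 := by
  have hid := step5_count Ω ω e he K' f
  have hM : 0 < finrank Q M := Module.finrank_pos
  have hH : 0 < finrank Q H := by
    rw [← hid]
    exact Nat.mul_pos hM hpos
  haveI := Module.nontrivial_of_finrank_pos hH
  exact exists_ne 0

end Count

section CentralCharacter

variable {V : Type*} [AddCommGroup V] [Module k V]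

/-- Proposition B5.3(e), the central-character constraint: if an element `z` of the level `K'`
acts on `V` by the scalar `c` (for Liu: a scalar isometry `z ∈ K' ∩ (A_E^∞)^1` acting on
`ω(μ, ε, χ)` by `χ(z)`, App. D.1 Step 3) and `V` has a non-zero `K'`-invariant vector, then `c = 1`. -/
theorem central_character_eq_one (ρ : Representation k G V) (K' : Subgroup G) {z : G} (hz : z ∈ K')
    {c : k} (hzc : ∀ v, ρ z v = c • v) {w : V} (hw : w ∈ invariants ρ K') (hw0 : w ≠ 0) : c = 1 := by
  have h1 : ρ z w = w := (mem_invariants_iff.1 hw) z hz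
  rw [hzc] at h1
  have h2 : (c - 1) • w = 0 := by
    rw [sub_smul, one_smul, h1, sub_self]
  rcases smul_eq_zero.1 h2 with h | h
  · exact sub_eq_zero.1 h
  · exact absurd h hw0

/-- Contrapositive form: a scalar `z ∈ K'` acting by `c ≠ 1` kills the `K'`-invariants. -/
theorem invariants_eq_bot_of_central_character_ne_one (ρ : Representation k G V) (K' : Subgroup G)
    {z : G} (hz : z ∈ K') {c : k} (hzc : ∀ v, ρ z v = c • v) (hc : c ≠ 1) :
    invariants ρ K' = ⊥ := by
  rw [Submodule.eq_bot_iff]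
  intro w hw
  by_contra hw0
  exact hc (central_character_eq_one ρ K' hz hzc hw hw0)

end CentralCharacter

end Summit.Ventures.HodgeRepro2.LevelPositivity
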